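import Mathlib.Analysis.Normed.Module.Basic
import Mathlib.Algebra.BigOperators.Group.Finset.Basic
import Mathlib.Data.Sign.Basic
import HarnessLib

/-!
# Band-sup overshoot: the three amplitude currencies of an R2/R3 row and the kernel cap

Cell `pub-fluidc` (FLUID COMPUTER; host summit `NavierStokesRegularity`, negation side, machine
paradigm), prover seat p1, R2 "AMPLITUDE RUNG" / R3 pass 0 (`HOME/PLAN.md` §0, `SCHEMA.md` 9.21,
ATLAS RULING R25 (iii)). HONEST FRAMING: low prior, high value-of-information experiment on Tao's
machine paradigm; NOT a claim that NS blows up. Nothing in this file is about the Navier–Stokes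
equations: it is the elementary DICTIONARY behind the cell's "currency" caveat on band sup-norms
(ATLAS R2 LANDING #8: at the record horizon the out-band sup of opt-adj's R3 pass-0 optimum is
`1.95 ×` the FULL-field sup; idea-1 P-G8-6 "physical cap", idea-2 P29 "projector ringing").

Currencies of one transfer step of scale ratio `λ` (atlas keys in brackets). At the start the field
has full sup `umax₀` and in-band sup `U_in(0)`; at the reading time it has full sup `umax_t` and
out-band sup `U_out` (`band_umax`). Then

* band gain `g = U_out / U_in(0)` (`amp_gain`), level-Reynolds ratio `r = g / λ` (`re_gain`);
* full-field gain `G = umax_t / umax₀`;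
* OVERSHOOT `Π = U_out / umax_t` — how far the band-limited component's maximum exceeds the
  maximum of the whole field (inter-band cancellation at a spike);
* in-band deficit `κ₀ = umax₀ / U_in(0)` (`= 1` when the start field lives entirely in the in band,
  as for opt-adj's band34 manifold).

Results (all over `ℝ`, hypotheses = positivity of the four sups):

* `bandGain_eq_overshoot_mul` — the ledger identity `g = Π · G · κ₀`.
* `div_le_overshoot_of_one_le_reRatio` — a row with `r ≥ 1` has `Π ≥ λ / (G κ₀)`; in particular
  (`one_lt_overshoot_of_one_le_reRatio`) if the full field gained less than the scale ratio,
  `G κ₀ < λ`, then `Π > 1`: the floor-passing amplitude is carried by overshoot, not by the field.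
* `reRatio_le_of_overshoot_le`, `reRatio_lt_one_of_overshoot_le` — conversely a CAP `Π ≤ C` on the
  projector gives `r ≤ C G κ₀ / λ`, so `r < 1` whenever `C G κ₀ < λ` (idea-1's `r_phys = G/λ` is the
  case `C = κ₀ = 1`).
* `norm_sum_kernel_smul_le` — WHERE A CAP COMES FROM (discrete Young inequality on a finite
  additive group, e.g. the `N³` lattice torus): a convolution-type band operator
  `(P u)(x) = ∑_y K(x - y) • u(y)` obeys `‖(P u)(x)‖ ≤ (∑_y |K y|) · sup_y ‖u y‖`, i.e. `Π ≤ ∑ |K|`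
  (`overshoot_le_kernel_norm`). For Littlewood–Paley blocks (smooth multipliers) this `ℓ¹` norm is
  bounded uniformly in the level — the currency in which the tree's floor
  `FluidComputer.LevelReynoldsFloor.dyadic_floor` [cite: CheskidovShvydkoy2010, Lemma 3.2] (pointer
  only) is stated; for SHARP spherical-shell projectors it is not, which is exactly why a sharp-band
  `r ≥ 1` row with `G < λ` is read as a candidate-in-waiting and not as a floor pass (R25 (iii)).

0 sorry; axioms ⊆ {propext, Classical.choice, Quot.sound}; no named fact introduced.
-/

noncomputable section

namespace Summit.NavierStokesRegularity.FluidComputer.BandSupOvershoot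

open Finset

/-! ## The three currencies -/

/-- Band amplitude gain `g = U_out / U_in(0)` (atlas key `amp_gain`). -/
def bandGain (Uout Uin0 : ℝ) : ℝ := Uout / Uin0

/-- Level-Reynolds ratio `r = g / λ` (atlas key `re_gain`). -/
def reRatio (lam Uout Uin0 : ℝ) : ℝ := bandGain Uout Uin0 / lam

/-- Overshoot `Π = U_out / umax_t`: band-limited sup over full-field sup at the reading time. -/
def overshoot (Uout umaxT : ℝ) : ℝ := Uout / umaxT

/-- Full-field gain `G = umax_t / umax₀`. -/
def fullGain (umaxT umax0 : ℝ) : ℝ := umaxT / umax0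

/-- In-band deficit `κ₀ = umax₀ / U_in(0)` of the start field (`= 1` if it is entirely in-band). -/
def inBandDeficit (umax0 Uin0 : ℝ) : ℝ := umax0 / Uin0

variable {lam Uout Uin0 umaxT umax0 C : ℝ}

/-- The ledger identity `g = Π · G · κ₀`. -/
theorem bandGain_eq_overshoot_mul (hUin0 : Uin0 ≠ 0) (humaxT : umaxT ≠ 0) (humax0 : umax0 ≠ 0) :
    bandGain Uout Uin0 = overshoot Uout umaxT * fullGain umaxT umax0 * inBandDeficit umax0 Uin0 := by
  unfold bandGain overshoot fullGain inBandDeficit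
  field_simp

/-- `G · κ₀ = umax_t / U_in(0)`. -/
theorem fullGain_mul_inBandDeficit (hUin0 : Uin0 ≠ 0) (humax0 : umax0 ≠ 0) :
    fullGain umaxT umax0 * inBandDeficit umax0 Uin0 = umaxT / Uin0 := by
  unfold fullGain inBandDeficit
  field_simp

/-- `r = Π · (G κ₀) / λ`. -/
theorem reRatio_eq (hUin0 : Uin0 ≠ 0) (humaxT : umaxT ≠ 0) (humax0 : umax0 ≠ 0) :
    reRatio lam Uout Uin0
      = overshoot Uout umaxT * (fullGain umaxT umax0 * inBandDeficit umax0 Uin0) / lam := by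
  unfold reRatio
  rw [bandGain_eq_overshoot_mul hUin0 humaxT humax0, mul_assoc]

/-- A floor-passing row forces overshoot: `r ≥ 1 ⟹ Π ≥ λ / (G κ₀)`. -/
theorem div_le_overshoot_of_one_le_reRatio (hlam : 0 < lam) (hUin0 : 0 < Uin0) (humaxT : 0 < umaxT)
    (humax0 : 0 < umax0) (hr : 1 ≤ reRatio lam Uout Uin0) :
    lam / (fullGain umaxT umax0 * inBandDeficit umax0 Uin0) ≤ overshoot Uout umaxT := by
  rw [fullGain_mul_inBandDeficit hUin0.ne' humax0.ne']
  unfold reRatio bandGain at hr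
  unfold overshoot
  have h1 : lam ≤ Uout / Uin0 := by
    rwa [le_div_iff₀ hlam, one_mul] at hr
  have h2 : lam * Uin0 ≤ Uout := by
    rwa [le_div_iff₀ hUin0] at h1
  rw [div_div_eq_mul_div, div_le_div_iff_of_pos_right humaxT]
  exact h2

/-- If the FULL field gained less than the scale ratio (`G κ₀ < λ`), an `r ≥ 1` row has `Π > 1`:
its floor-passing amplitude is carried by the projector's overshoot. -/
theorem one_lt_overshoot_of_one_le_reRatio (hlam : 0 < lam) (hUin0 : 0 < Uin0) (humaxT : 0 < umaxT)
    (humax0 : 0 < umax0) (hr : 1 ≤ reRatio lam Uout Uin0)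
    (hG : fullGain umaxT umax0 * inBandDeficit umax0 Uin0 < lam) :
    1 < overshoot Uout umaxT := by
  have hpos : 0 < fullGain umaxT umax0 * inBandDeficit umax0 Uin0 := by
    rw [fullGain_mul_inBandDeficit hUin0.ne' humax0.ne']
    exact div_pos humaxT hUin0
  have h := div_le_overshoot_of_one_le_reRatio hlam hUin0 humaxT humax0 hr
  exact lt_of_lt_of_le ((one_lt_div hpos).mpr hG) h

/-- A cap on the overshoot bounds the ratio: `Π ≤ C ⟹ r ≤ C · G κ₀ / λ`. -/
theorem reRatio_le_of_overshoot_le (hlam : 0 < lam) (hUin0 : 0 < Uin0) (humaxT : 0 < umaxT)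
    (humax0 : 0 < umax0) (hC : overshoot Uout umaxT ≤ C) :
    reRatio lam Uout Uin0 ≤ C * (fullGain umaxT umax0 * inBandDeficit umax0 Uin0) / lam := by
  rw [reRatio_eq hUin0.ne' humaxT.ne' humax0.ne']
  have hpos : 0 < fullGain umaxT umax0 * inBandDeficit umax0 Uin0 := by
    rw [fullGain_mul_inBandDeficit hUin0.ne' humax0.ne']
    exact div_pos humaxT hUin0
  exact div_le_div_of_nonneg_right (mul_le_mul_of_nonneg_right hC hpos.le) hlam.le

/-- The capped reading falls below the floor when `C · G κ₀ < λ` (idea-1's `r_phys = G/λ < 1` is the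
case `C = κ₀ = 1`). -/
theorem reRatio_lt_one_of_overshoot_le (hlam : 0 < lam) (hUin0 : 0 < Uin0) (humaxT : 0 < umaxT)
    (humax0 : 0 < umax0) (hC : overshoot Uout umaxT ≤ C)
    (h : C * (fullGain umaxT umax0 * inBandDeficit umax0 Uin0) < lam) :
    reRatio lam Uout Uin0 < 1 := by
  have h1 := reRatio_le_of_overshoot_le hlam hUin0 humaxT humax0 hC
  exact lt_of_le_of_lt h1 ((div_lt_one hlam).mpr h)

/-! ## Where a cap comes from: the discrete Young inequality for a convolution-type band operator -/

section Kernel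

variable {G : Type*} [AddCommGroup G] [Fintype G]
variable {E : Type*} [SeminormedAddCommGroup E] [NormedSpace ℝ E]

/-- Discrete Young inequality (`ℓ¹ × ℓ^∞ → ℓ^∞`) on a finite additive group: a convolution-type operator
`(P u)(x) = ∑_y K(x - y) • u(y)` with scalar kernel `K` satisfies
`‖(P u)(x)‖ ≤ (∑_y |K y|) · M` whenever `‖u y‖ ≤ M` for all `y`. -/
theorem norm_sum_kernel_smul_le (K : G → ℝ) (u : G → E) (x : G) {M : ℝ}
    (hM : ∀ y, ‖u y‖ ≤ M) :
    ‖∑ y, K (x - y) • u y‖ ≤ (∑ y, |K y|) * M := by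
  have hM0 : 0 ≤ M := le_trans (norm_nonneg _) (hM x)
  calc ‖∑ y, K (x - y) • u y‖
      ≤ ∑ y, ‖K (x - y) • u y‖ := norm_sum_le _ _
    _ = ∑ y, |K (x - y)| * ‖u y‖ := by
        refine Finset.sum_congr rfl fun y _ => ?_
        rw [norm_smul, Real.norm_eq_abs]
    _ ≤ ∑ y, |K (x - y)| * M := by
        refine Finset.sum_le_sum fun y _ => ?_
        exact mul_le_mul_of_nonneg_left (hM y) (abs_nonneg _)
    _ = (∑ y, |K (x - y)|) * M := by rw [Finset.sum_mul]
    _ = (∑ y, |K y|) * M := by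
        congr 1
        exact Fintype.sum_equiv (Equiv.subLeft x) (fun y => |K (x - y)|) (fun y => |K y|)
          (fun y => rfl)

/-- The overshoot of a kernel band operator is capped by the kernel's `ℓ¹` norm:
if `‖u y‖ ≤ umax` everywhere and `umax > 0`, then `‖(P u)(x)‖ / umax ≤ ∑_y |K y|` at every `x`. -/
theorem overshoot_le_kernel_norm (K : G → ℝ) (u : G → E) (x : G) {umax : ℝ} (hpos : 0 < umax)
    (hM : ∀ y, ‖u y‖ ≤ umax) :
    overshoot ‖∑ y, K (x - y) • u y‖ umax ≤ ∑ y, |K y| := by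
  unfold overshoot
  rw [div_le_iff₀ hpos]
  exact norm_sum_kernel_smul_le K u x hM

end Kernel

/-! ## The cap is sharp: the kernel's `ℓ¹` norm is ATTAINED (appended 2026-08-23, p1 gen 4)

p2's certified Lebesgue constants (`HOME/atlas/rung-next/p2-lebesgue-cert/`, STATUS 2026-08-23 09:25Z) and p1's
kinematic-cap table quote `L = (1/N³) ∑_x |D(x)|` as THE `ℓ^∞ → ℓ^∞` norm of a band projector on the `N³` grid, not
merely an upper bound. The upper bound is `norm_sum_kernel_smul_le` above; the lower bound is the sign field below:
at any point `x`, the unit-sup field `u(y) = sign K(x − y)` makes `(P u)(x) = ∑_y |K y|` exactly. -/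

section Sharp

variable {G : Type*} [AddCommGroup G] [Fintype G]

/-- The sign witness has sup norm at most `1`. -/
theorem abs_sign_le_one (r : ℝ) : |(SignType.sign r : ℝ)| ≤ 1 := by
  rcases lt_trichotomy r 0 with h | h | h
  · rw [sign_neg h]; simp
  · rw [h, sign_zero]; simp
  · rw [sign_pos h]; simp

/-- At the point `x`, the sign field `u(y) = sign K(x − y)` turns the band operator's value into the kernel's
`ℓ¹` norm: `∑_y K(x − y) · sign K(x − y) = ∑_y |K y|`. -/
theorem sum_kernel_mul_sign_eq (K : G → ℝ) (x : G) :
    ∑ y, K (x - y) * (SignType.sign (K (x - y)) : ℝ) = ∑ y, |K y| := by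
  calc ∑ y, K (x - y) * (SignType.sign (K (x - y)) : ℝ)
      = ∑ y, |K (x - y)| := by
        refine Finset.sum_congr rfl fun y _ => ?_
        rw [mul_comm]; exact sign_mul_self (K (x - y))
    _ = ∑ y, |K y| :=
        Fintype.sum_equiv (Equiv.subLeft x) (fun y => |K (x - y)|) (fun y => |K y|) (fun y => rfl)

/-- SHARPNESS of the discrete Young cap: for every scalar kernel `K` on a finite additive group and every point
`x` there is a real field `u` with `|u y| ≤ 1` everywhere whose image `(P u)(x) = ∑_y K(x − y) • u(y)` EQUALS
`∑_y |K y|`. Together with `norm_sum_kernel_smul_le` (`M = 1`): `∑_y |K y|` is exactly the `ℓ^∞ → ℓ^∞` operator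
norm of `P` — the number a kinematic-cap / Lebesgue-constant table lists. -/
theorem exists_unit_field_attaining_kernel_norm (K : G → ℝ) (x : G) :
    ∃ u : G → ℝ, (∀ y, ‖u y‖ ≤ 1) ∧ ∑ y, K (x - y) • u y = ∑ y, |K y| :=
  ⟨fun y => (SignType.sign (K (x - y)) : ℝ), fun y => by rw [Real.norm_eq_abs]; exact abs_sign_le_one _,
    by simpa only [smul_eq_mul] using sum_kernel_mul_sign_eq K x⟩

/-- The cap as an equality of real numbers: the supremum of `|(P u)(x)|` over real fields with `|u| ≤ 1` is
attained and equals `∑_y |K y|`; stated without `sSup` as "upper bound + witness". -/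
theorem kernel_norm_isGreatest (K : G → ℝ) (x : G) :
    IsGreatest {v : ℝ | ∃ u : G → ℝ, (∀ y, ‖u y‖ ≤ 1) ∧ v = ‖∑ y, K (x - y) • u y‖} (∑ y, |K y|) := by
  refine ⟨?_, ?_⟩
  · obtain ⟨u, hu, h⟩ := exists_unit_field_attaining_kernel_norm K x
    refine ⟨u, hu, ?_⟩
    rw [h, Real.norm_eq_abs, abs_of_nonneg (Finset.sum_nonneg fun y _ => abs_nonneg _)]
  · rintro v ⟨u, hu, rfl⟩
    simpa using norm_sum_kernel_smul_le K u x hu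

end Sharp

end Summit.NavierStokesRegularity.FluidComputer.BandSupOvershoot

end
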